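import Summits.ResolutionOfSingularities.ResolutionOfSingularities.Theorems.EquisingularLiftEquisingularLiftNatNDModelInitChart
import Summits.ResolutionOfSingularities.ResolutionOfSingularities.Theorems.EquisingularLiftEquisingularLiftNatNDRoundModelSplit
import Literature.AlgebraicGeometry.Resolution.BlowupDisjointCentreSplitting
import HarnessLib

/-!
# [OURS · L1 W4.5(b) · EL♮(3) · ND-K5 (B4α1i)] `ND.modelInit`: ANY blow-up of the origin of `𝔸ⁿ_k` is a toric stage at the point-star fan

THE ND-K5 BRICK (B4α1i) of res-L1-w45b-idea-1's spec (v11/v12 §13.14, port ✓ p643982 `…NatNDRoundModelSplit`: `ND.ToricStage`, `ND.ModelInit`) BY NAME: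
`modelInit (n) (k) [Field k] [IsAlgClosed k] (g) (hg : LocalND g) : ModelInit n k g`.  WIDTH, `--supports stmt-ResolutionOfSingularities-20148`, no claim,
counted 0 (res-L1-w45b-stub-4 g11).  AI-produced kernel work weaker than expert review; no statement of [Hironaka2017] is used; EL♮(3) is NOT proved here.

PROOF.  `n = 0` is vacuous (`not_localND_zero`: a polynomial in no variables with zero constant coefficient is `0`, contradicting
`IsLocallyNewtonNondegenerate`).  For `n = m + 1`: (TS0) the cones of `star (orthantFan (m+1)) frame` are the smooth point cones
(`isSmoothCone_of_mem_star_orthant`, ✓ p642931 `…NatNDPointChart`); (TS1) the chart clause is `modelInit_chart` (✓ p643794 `…NatNDModelInitChart`, over the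
Literature coordinate blow-up charts `AffineCoordBlowup.chartImm` and the strict-transform dictionary ✓ p642967 / ✓ p643256); (TS2) a blow-up of the reduced origin
is an isomorphism off it (`IsBlowup.isIso_morphismRestrict_compl_of_vanishingIdeal`); (TS3) `closure S ∩ U = S` for the relatively closed `S = π₀⁻¹(V(g) ∖ 0)` of
the open `U = π₀⁻¹ {0}ᶜ`; (TS4) `isClosed_closure`; (TS5) the new ray `𝟙` carries `𝓘{0}·𝒪` with support `π₀⁻¹ {0}` (`support_comap`), every other non-frame ray
is absent (`frameBoundary_of_not_mem_range`, `strictTransformIdeal_top`).  `[IsAlgClosed k]` is carried by the spec's signature, not used.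
-/

set_option linter.dupNamespace false

noncomputable section

open CategoryTheory AlgebraicGeometry TopologicalSpace MvPolynomial
open Literature.AlgebraicGeometry.Resolution
open AlgebraicGeometry.Scheme.IdealSheafData

namespace Summit.ResolutionOfSingularities.ResolutionOfSingularities.Cruxes.EquisingularLiftNat.Sections.ND


section B4α1i

variable (n : ℕ) (k : Type) [Field k]

/-- In dimension `0` there is no local ND datum: a polynomial in no variables with zero constant coefficient is `0`, contradicting
`IsLocallyNewtonNondegenerate`. [OURS · small print] -/
theorem not_localND_zero (g : MvPolynomial (Fin 0) k) : ¬ LocalND g := by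
  rintro ⟨⟨h0, -⟩, hND⟩
  apply ne_zero_of_isLocallyND hND
  rw [eq_C_of_isEmpty g]
  change C (constantCoeff g) = 0
  rw [h0, C_0]

/-- **(B4α1i) `modelInit`**: ANY blow-up of the origin of `𝔸ⁿ_k` is a toric stage at the point-star fan, with the stepped coordinate frame boundary
and the strict transform of `V(g)` (`g` with local ND data; only convenience and `g ≠ 0` are used).  `n = 0` is vacuous (`not_localND_zero`); for
`n = m + 1` the chart clause is `modelInit_chart` (`…NatNDModelInitChart`), the cones of the point star are the smooth point cones
(`…NatNDPointChart`), the blow-up is an isomorphism off the origin (`IsBlowup.isIso_morphismRestrict_compl_of_vanishingIdeal`), the bookkeeping and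
the support clauses are elementary. [OURS · L1 W4.5b · ND-K5 (B4α1i)] -/
theorem modelInit [IsAlgClosed k] (g : MvPolynomial (Fin n) k) (hg : LocalND g) : ModelInit n k g := by
  classical
  obtain _ | m := n
  · exact absurd hg (not_localND_zero k g)
  intro A₂ π₀ hπ₀
  have hconv : IsConvenientTable (table g) := isConvenientTable_table hg.1
  have hg0 : g ≠ 0 := ne_zero_of_isLocallyND hg.2
  refine ⟨fun σ hσ => isSmoothCone_of_mem_star_orthant m hσ, fun x => modelInit_chart m k hconv hg0 π₀ hπ₀ x, ?_, ?_, isClosed_closure, ?_⟩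
  · -- (TS2) the blow-up is an isomorphism off the origin
    exact hπ₀.isIso_morphismRestrict_compl_of_vanishingIdeal
  · -- (TS3) bookkeeping off the origin: `closure S ∩ U = S` for `S = π₀⁻¹(V(g) ∖ 0)` closed in the open `U = π₀⁻¹ {0}ᶜ`
    apply le_antisymm
    · rintro y ⟨hy, hyU⟩
      have hcl : closure (π₀ ⁻¹' (PrimeSpectrum.zeroLocus {g} \ {affOrigin (m + 1) k})) ⊆ π₀ ⁻¹' PrimeSpectrum.zeroLocus {g} :=
        closure_minimal (Set.preimage_mono Set.sdiff_subset) ((PrimeSpectrum.isClosed_zeroLocus _).preimage π₀.continuous)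
      exact ⟨hcl hy, hyU⟩
    · intro y hy
      exact ⟨subset_closure hy, hy.2⟩
  · -- (TS5) the non-frame members of the stepped boundary lie over the origin
    intro ρ hρ
    by_cases h1 : ρ = 1
    · subst h1
      rw [stepAlong_self, support_comap, Closeds.coe_preimage, Scheme.IdealSheafData.coe_support_vanishingIdeal]
      exact subset_rfl
    · rw [stepAlong_of_ne _ _ h1, frameBoundary_of_not_mem_range _ hρ, strictTransformIdeal_top, Scheme.IdealSheafData.support_top]
      exact fun y hy => absurd hy (by simp)

end B4α1i

end Summit.ResolutionOfSingularities.ResolutionOfSingularities.Cruxes.EquisingularLiftNat.Sections.ND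

end
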